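import Summits.AtomisticToContinuum.BoseEinsteinCondensation.Theorems.BECConjugateDominationNearMinimiserStability
import Literature.MathematicalPhysics.QuantumManyBody.PeriodicGroundStateNondegenerateProofs
import HarnessLib

/-!
# Route BECConjugateDomination — `NearMinimiserStability` PROVED (item stmt-AtomisticToContinuum-11788)

Closes the item: the conditional theorem `nearMinimiserStability_of_nondegenerate`
(`BECConjugateDominationNearMinimiserStability.lean`: min–max in the form domain, gap inequality,
phase alignment, `n₀` Lipschitz) composed with the discharge
`Literature.MathematicalPhysics.QuantumManyBody.PeriodicGroundStateNondegenerate_holds`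
(`PeriodicGroundStateNondegenerateProofs.lean`: Feynman–Kac / Perron–Frobenius on the torus, Reed–Simon IV
§XIII.12) gives the route statement unconditionally, for both routes that want it verbatim
(`BECConjugateDomination`, `BECPhaseQuadratureSumRule`).
-/

namespace Summit.AtomisticToContinuum.BoseEinsteinCondensation.Theorems

open Literature.MathematicalPhysics.QuantumManyBody

/-- **`NearMinimiserStability` (route `BECConjugateDomination`), proved.** At fixed `N`, `L > 0` with
finite periodic ground-state energy, for every `ε > 0` there is `δ > 0` such that every minimiser `Ψ`
and every `δ`-near-minimiser `Φ` of the periodic `N`-body energy satisfy `n₀(Ψ) ≤ n₀(Φ) + εN`: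
`nearMinimiserStability_of_nondegenerate` (min–max + phase alignment + Lipschitz `n₀`) applied to the
proved nondegeneracy of the bosonic torus ground state `PeriodicGroundStateNondegenerate_holds`.
[cite: ReedSimonIV1978, Thm. XIII.1 and §XIII.12 Thms XIII.43–XIII.46] -/
theorem nearMinimiserStability_proof : Theses.BECConjugateDomination.NearMinimiserStability :=
  nearMinimiserStability_of_nondegenerate PeriodicGroundStateNondegenerate_holds

/-- **`NearMinimiserStability` (route `BECPhaseQuadratureSumRule`, verbatim twin), proved.**
[cite: ReedSimonIV1978, Thm. XIII.1 and §XIII.12 Thms XIII.43–XIII.46] -/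
theorem phaseQuadrature_nearMinimiserStability_proof :
    Theses.BECPhaseQuadratureSumRule.NearMinimiserStability :=
  phaseQuadrature_nearMinimiserStability_of_nondegenerate PeriodicGroundStateNondegenerate_holds

end Summit.AtomisticToContinuum.BoseEinsteinCondensation.Theorems
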